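import Summits.CriticalPhenomena.PercolationContinuityZ3.Theorems.PercNearOneGluingNoHeavyLowerTailAntitheticHandleDual
import Summits.CriticalPhenomena.PercolationContinuityZ3.Theorems.PercNearOneGluingNoHeavyLowerTailAntitheticTransport
import Summits.CriticalPhenomena.PercolationContinuityZ3.Theorems.PercNearOneGluingNoHeavyLowerTailAntitheticK4Oplus
import Summits.CriticalPhenomena.PercolationContinuityZ3.Theorems.PercNearOneGluingNoHeavyLowerTailAntitheticApexMixed
import HarnessLib

/-!
# `NoHeavyLowerTail` (stmt-CriticalPhenomena-4575) — antithetic cluster pairs: **THEOREM K4H — `K₄` PLUS A HANDLE** (the vertex antithetic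
# inequality at `R = {x}` / CONJECTURE Δ2 for the unique 2-connected failure of the box census through 7 vertices, for ALL arm lengths;
# prim-hp-2 gen 64, HOME/MEMO-gen64.md §3)

Support file (`--supports stmt-CriticalPhenomena-4575`, hull-port prover `prim-hp-2`, gen 64).  No definitions, no named facts, no sorries;
standard axioms (the ⊕-input …AntitheticK4Oplus is a `native_decide`-checked certificate).  VERTEX version.

THE GRAPH.  `K = K₄` on `c 0 = s, c 1, c 2, c 3` (`c : Fin 4 → V` injective; edge set `E₀ = Sym2.map c '' {01,02,03,12,13,23}`), a handle
`P = c 1 – u 1 – … – u a = y – x – z = w b – … – w 1 – Q = c q` (`q ≠ 0`; `q = 1` is the ear of `x` returning to `P`; arms of fresh vertices,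
`a, b ≥ 0`; `x` fresh; `yz ∉ H`).  By the exhaustive box census of gen 62 (HOME/MEMO-gen62.md §1(c), kit j254072) `K₄ + handle` with `s ∈ K₄` is
the ONLY 2-connected configuration on ≤ 7 vertices whose mixed event has no red-dominated box partition in either orientation (`λ(s, P) =
λ(s, Q) = 3`: `{P ∈ X_{K₄}}` is not box-decomposable); it is settled here for every `a, b`:
* `Antithetic.K4.handle_vertex_sum_nonneg` — **THEOREM K4H**: for all monotone `F, G`,
  `0 ≤ Σ_{ω : ¬(x ∈ X_E ω ∧ x ∈ Y_E ω)} (F(X_E ω) − F(Y_E ω))·(G(X_E ω) − G(Y_E ω))`, `E = K₄ ∪ arms + xy + xz`.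
PROOF = the DUAL HANDLE THEOREM (…AntitheticHandleDual: (⊕) + (M) for the base graph only, via the 1-SUM LEMMA) with
(⊕) = the checked pair-cube certificate `Antithetic.K4.oplus_powerset` on `Fin 4` TRANSPORTED along `c` (`Antithetic.Transport.oplus_of_powerset`)
and (M) = `Antithetic.Apex.mixed_nonneg` (every vertex of `K₄` is an apex: on `{Q ∉ Y}` the blue cluster is inside the red one).
* `Antithetic.K4.no_loops`, `Antithetic.K4.apex` — bookkeeping: the image edge set has no loops and every `c q` is an apex of it.
[cite: VandenbergHaggstromKahn2005, §1 p. 6 ("Harris' inequality"), §1 p. 3 (open cluster `C_s`)]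
-/

noncomputable section

namespace Summit.CriticalPhenomena.PercolationContinuityZ3.Theorems

open Literature.Probability.Percolation
open scoped Classical

namespace Antithetic

namespace K4

variable {V : Type*} {c : Fin 4 → V} (hc : Function.Injective c) {E₀ : Set (Sym2 V)}
  (hE₀ : E₀ = Sym2.map c '' ↑({s(0, 1), s(0, 2), s(0, 3), s(1, 2), s(1, 3), s(2, 3)} : Finset (Sym2 (Fin 4))))
include hc hE₀

/-- The image edge set of `K₄` has no loops. [this work] -/
theorem no_loops : ∀ f ∈ E₀, ¬ f.IsDiag := by
  have hK : ∀ e ∈ ({s(0, 1), s(0, 2), s(0, 3), s(1, 2), s(1, 3), s(2, 3)} : Finset (Sym2 (Fin 4))), ¬ e.IsDiag := by decide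
  rw [hE₀]
  rintro f ⟨e, he, rfl⟩
  have hne := hK e (Finset.mem_coe.1 he)
  induction e using Sym2.ind with
  | h i j =>
    rw [Sym2.map_mk, Sym2.mk_isDiag_iff]
    rw [Sym2.mk_isDiag_iff] at hne
    exact fun h => hne (hc h)

omit hc in
/-- Every vertex `c q` of `K₄` is an apex of its image edge set. [this work] -/
theorem apex (q : Fin 4) : ∀ e ∈ E₀, ∀ v ∈ e, v ≠ c q → s(v, c q) ∈ E₀ := by
  have hK : ∀ i j : Fin 4, i ≠ j → s(i, j) ∈ ({s(0, 1), s(0, 2), s(0, 3), s(1, 2), s(1, 3), s(2, 3)} : Finset (Sym2 (Fin 4))) := by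
    decide
  rw [hE₀]
  rintro f ⟨e, he, rfl⟩ v hv hvq
  induction e using Sym2.ind with
  | h i j =>
    rw [Sym2.map_mk] at hv
    have hv' : ∃ k, v = c k := by
      rcases Sym2.mem_iff.1 hv with rfl | rfl
      · exact ⟨i, rfl⟩
      · exact ⟨j, rfl⟩
    obtain ⟨k, rfl⟩ := hv'
    have hkq : k ≠ q := fun h => hvq (by rw [h])
    exact ⟨s(k, q), Finset.mem_coe.2 (hK k q hkq), Sym2.map_mk _ _ _⟩

variable [Fintype V] {q : Fin 4} {u w : ℕ → V} {a b : ℕ}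
  (hu0 : u 0 = c 1) (hw0 : w 0 = c q)
  (hufresh : ∀ i, 0 < i → i ≤ a → ∀ f ∈ E₀ ∪ Cyc.edgeSet b w, u i ∈ f → f.IsDiag)
  (hwfresh : ∀ i, 0 < i → i ≤ b → ∀ f ∈ E₀, w i ∈ f → f.IsDiag)
  (huinj : ∀ i j, i ≤ a → j ≤ a → u i = u j → i = j) (hwinj : ∀ i j, i ≤ b → j ≤ b → w i = w j → i = j)
  (hsu : ∀ i, 0 < i → i ≤ a → c 0 ≠ u i) (hsw : ∀ i, 0 < i → i ≤ b → c 0 ≠ w i)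
  (hPw : ∀ i, 0 < i → i ≤ b → c 1 ≠ w i) (hzu : ∀ i, 0 < i → i ≤ a → w b ≠ u i)
include hu0 hw0 hufresh hwfresh huinj hwinj hsu hsw hPw hzu

/-- **THEOREM K4H (`K₄` + handle, all arm lengths).**  `K₄` on `c 0 = s, c 1, c 2, c 3` (`c` injective, image edge set `E₀`), a handle from
`P = c 1` to `Q = c q` (any `q`; arms `u 0 = c 1, …, u a = y` and `w 0 = c q, …, w b = z` of fresh vertices, `a, b ≥ 0`), `x` fresh joined to
`y, z`, `yz ∉ H = E₀ ∪ arms`, `E = H + xy + xz`.  Then for all monotone `F, G`: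
`0 ≤ Σ_{ω : ¬(x ∈ X_E ω ∧ x ∈ Y_E ω)} (F(X_E ω) − F(Y_E ω))·(G(X_E ω) − G(Y_E ω))`. [this work] -/
theorem handle_vertex_sum_nonneg {x : V}
    (hx : ∀ f ∈ Cyc.edgeSet a u ∪ (Cyc.edgeSet b w ∪ E₀), x ∈ f → f.IsDiag)
    (hxs : x ≠ c 0) (hxy : x ≠ u a) (hxz : x ≠ w b) (hyz : u a ≠ w b) (hg : s(u a, w b) ∉ Cyc.edgeSet a u ∪ (Cyc.edgeSet b w ∪ E₀))
    {F G : Set V → ℝ} (hF : Monotone F) (hG : Monotone G) :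
    0 ≤ ∑ ω ∈ Finset.univ.filter (fun ω : Set (Sym2 V) =>
        ¬ ((openGraph (ω ∩ insert s(x, u a) (insert s(x, w b) (Cyc.edgeSet a u ∪ (Cyc.edgeSet b w ∪ E₀))))).Reachable (c 0) x ∧
          (openGraph (ωᶜ ∩ insert s(x, u a) (insert s(x, w b) (Cyc.edgeSet a u ∪ (Cyc.edgeSet b w ∪ E₀))))).Reachable (c 0) x)),
      (F (openCluster (ω ∩ insert s(x, u a) (insert s(x, w b) (Cyc.edgeSet a u ∪ (Cyc.edgeSet b w ∪ E₀)))) (c 0)) -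
          F (openCluster (ωᶜ ∩ insert s(x, u a) (insert s(x, w b) (Cyc.edgeSet a u ∪ (Cyc.edgeSet b w ∪ E₀)))) (c 0))) *
        (G (openCluster (ω ∩ insert s(x, u a) (insert s(x, w b) (Cyc.edgeSet a u ∪ (Cyc.edgeSet b w ∪ E₀)))) (c 0)) -
          G (openCluster (ωᶜ ∩ insert s(x, u a) (insert s(x, w b) (Cyc.edgeSet a u ∪ (Cyc.edgeSet b w ∪ E₀)))) (c 0))) := by
  -- (the edge set of `H` is written `arm ∪ (stub ∪ E₀)`; the dual handle theorem writes `arm ∪ (E₀ ∪ stub)`)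
  have hcomm : Cyc.edgeSet b w ∪ E₀ = E₀ ∪ Cyc.edgeSet b w := Set.union_comm _ _
  rw [hcomm] at hx hg ⊢
  -- (⊕): the checked certificate on `Fin 4`, transported along `c`
  --      (the certificate file carries the computable `Decidable` instance of `SimpleGraph.Reachable`; `convert` + `Finset.filter_congr`
  --      identify its event filter with the classical one of the transport lemma without unfolding either instance)
  have hop := fun (K₁ K₂ : Set V → Set V → ℝ) hK₁ hso₁ hK₂ hso₂ =>
    Transport.oplus_of_powerset hc ({s(0, 1), s(0, 2), s(0, 3), s(1, 2), s(1, 3), s(2, 3)} : Finset (Sym2 (Fin 4))) 0 1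
      (fun L₁ L₂ hL₁ hsoL₁ hL₂ hsoL₂ => by
        convert oplus_powerset L₁ L₂ hL₁ hsoL₁ hL₂ hsoL₂ using 9)
      hE₀ K₁ K₂ hK₁ hso₁ hK₂ hso₂
  -- (M): `c q` is an apex
  have hmix := fun (K₁ K₂ : Set V → Set V → ℝ) hK₁ hso₁ hK₂ hso₂ =>
    Apex.mixed_nonneg (E := E₀) (s := c 0) (apex hE₀ q) (c 1) K₁ K₂ hK₁ hso₁ hK₂ hso₂
  have h := Pendant.handle_vertex_sum_nonneg_of_oplus (no_loops hc hE₀) hwfresh hwinj hsw hPw hop hu0 hw0 hufresh huinj hsu hzu hmix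
    hx hxs hxy hxz hyz hg hF hG
  -- (the two sides may carry different `Decidable` instances for the event; `convert` identifies them)
  convert h using 3

end K4

end Antithetic

end Summit.CriticalPhenomena.PercolationContinuityZ3.Theorems
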